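import Literature.NumberTheory.Automorphic.AdelicPiSchwartzBruhatFourierInversion
import HarnessLib

/-!
# The Weyl element of the theta representation: `𝓕` as an invertible operator of `𝒮(X_A)` stabilising `Θ`

Topic `NumberTheory/Weil1964`; namespace `Literature.NumberTheory.Weil1964`. KERNEL MATHEMATICS ONLY: no
`def … : Prop` records, no `axiom`, no `sorry`; every `[cite: …]` / `[folklore]` tag is provenance for a
kernel-checked statement.

`AdelicThetaDistribution` packaged the adelic Fourier transform of `X_A = 𝔸_F^ι` as a linear endomorphism
`fourierLM F ι ν` of `𝒮(X_A) = piSchwartzBruhat F ι` and proved Poisson summation in the form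
`Θ(𝓕Φ) = ν(D^ι) Θ(Φ)`; `AdelicSecondDegreeCharacter` put the rational generators `d(γ)` (`γ ∈ GL_n(F)`) and
`t(σ)` (`σ ∈ M_n(F)` symmetric or not) of Weil's pseudo-symplectic group inside the stabiliser
`thetaStabilizer F ι ≤ (End 𝒮(X_A))ˣ` of `Θ`. What was missing for the **Weyl element** `w` — which acts
on `𝒮(X_A)` by the Fourier transform [Weil1964, n° 13] — is that `𝓕` is an INVERTIBLE operator of `𝒮(X_A)`,
i.e. the Fourier inversion formula. From `AdelicPiSchwartzBruhatFourierInversion`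
(`Φ̂̂(x) = ν(D^ι)² Φ(-x)`) this file PROVES, for the self-dual normalisation `ν(D^ι) = 1`:

* `negLM`, `negUnit` — the reflection `Φ ↦ Φ(-·)` as an operator of `𝒮(X_A)` of order `2`, in the
  stabiliser of `Θ` (`negUnit_mem_thetaStabilizer`, reindexing `ξ ↦ -ξ` of `X_k`);
* `fourierLM_fourierLM_of_measure_eq_one : 𝓕 ∘ 𝓕 = (Φ ↦ Φ(-·))` on `𝒮(X_A)` (and the unnormalised
  `fourierLM_fourierLM : 𝓕_ν ∘ 𝓕_ν = ν(D^ι)² · (Φ ↦ Φ(-·))`), `𝓕` commutes with the reflection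
  (`fourierLM_mul_negLM_comm`, purely algebraically from `𝓕² = N`, `N² = 1`);
* `fourierUnit` — `𝓕` as an element of `(End 𝒮(X_A))ˣ` with inverse `𝓕 ∘ N = 𝓕³`, of order dividing `4`
  (`fourierUnit_mul_fourierUnit = negUnit`, `fourierUnit_pow_four`), the linear automorphism `fourierEquiv`;
* `fourierUnit_mem_thetaStabilizer : 𝓕 ∈ thetaStabilizer` — the invariance conjunct `Θ(wΦ) = Θ(Φ)` of Weil's
  Théorème 6 for the Weyl element, in the concrete adelic model — and
  `closure_ratGL_ratMatrix_fourierUnit_le_thetaStabilizer`: the subgroup of `(End 𝒮(𝔸_Fⁿ))ˣ` generated by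
  the rational `d(γ)`, `t(σ)` AND `w` stabilises `Θ`.

Not in this file (separate statements of the model): the Bruhat-type generation `Sp(X_k) = ⟨P(X_k), w⟩`
and the identification of `fourierUnit` with the image of the Weyl element under a given projective
representation (a scalar — the Weil index — intervenes there [Weil1964, n° 14–16]).

## References

* A. Weil, *Sur certains groupes d'opérateurs unitaires*, Acta Math. 111 (1964): n° 13 (the operator of
  `w` is the Fourier transform), n° 41 Théorème 6 p. 193 (invariance of `Θ` under `Ps(X)_k ∋ w`) [Weil1964].
* J. Tate, in Cassels–Fröhlich, *Algebraic Number Theory* (1967), Ch. XV Thm. 4.1.2 (inversion), Thm.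
  4.1.3 (2) (`μ(D) = 1`) [CasselsFrohlichANT1967].
-/

noncomputable section

open scoped BigOperators NNReal ENNReal Topology Classical
open NumberField MeasureTheory MeasureTheory.Measure IsDedekindDomain

namespace Literature.NumberTheory.Weil1964

open Literature.NumberTheory.Automorphic

/-! ### The reflection `Φ ↦ Φ(-·)` -/

section Reflection

variable (F : Type) [Field F] [NumberField F] (ι : Type)

variable {F ι} in
/-- **`Θ(Φ(-·)) = Θ(Φ)`** for every `Φ : X_A → ℂ` (reindexing `ξ ↦ -ξ` of `X_k`, `ratPt_neg`; no convergence
needed). [folklore] -/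
theorem thetaDist_comp_neg (Φ : (ι → AdeleRing (𝓞 F) F) → ℂ) :
    thetaDist F ι (fun v => Φ (-v)) = thetaDist F ι Φ := by
  simp only [thetaDist_def]
  simp_rw [← ratPt_neg]
  exact (Equiv.neg (ι → F)).tsum_eq fun ξ => Φ (ratPt F ι ξ)

variable [Fintype ι]

/-- **The reflection operator** `N : Φ ↦ Φ(-·)` of `𝒮(X_A)` (stability: `comp_neg_mem_piSchwartzBruhat`).
[folklore] -/
def negLM : piSchwartzBruhat F ι →ₗ[ℂ] piSchwartzBruhat F ι where
  toFun Φ := ⟨fun v => (Φ : (ι → AdeleRing (𝓞 F) F) → ℂ) (-v), comp_neg_mem_piSchwartzBruhat Φ.2⟩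
  map_add' _ _ := Subtype.ext (funext fun _ => rfl)
  map_smul' _ _ := Subtype.ext (funext fun _ => rfl)

variable {F ι}

/-- Unfolding of `negLM` on underlying functions. [folklore] -/
@[simp] theorem coe_negLM (Φ : piSchwartzBruhat F ι) :
    ((negLM F ι Φ : piSchwartzBruhat F ι) : (ι → AdeleRing (𝓞 F) F) → ℂ) =
      fun v => (Φ : (ι → AdeleRing (𝓞 F) F) → ℂ) (-v) := rfl

/-- `N (N Φ) = Φ`. [folklore] -/
@[simp] theorem negLM_negLM (Φ : piSchwartzBruhat F ι) : negLM F ι (negLM F ι Φ) = Φ :=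
  Subtype.ext (funext fun v => congrArg (Φ : (ι → AdeleRing (𝓞 F) F) → ℂ) (neg_neg v))

/-- `N ∘ N = 1` in `End 𝒮(X_A)`. [folklore] -/
theorem negLM_mul_negLM : negLM F ι * negLM F ι = 1 :=
  LinearMap.ext fun Φ => negLM_negLM Φ

variable (F ι) in
/-- **The reflection as an invertible operator** of `𝒮(X_A)` (its own inverse). [folklore] -/
def negUnit : (Module.End ℂ (piSchwartzBruhat F ι))ˣ where
  val := negLM F ι
  inv := negLM F ι
  val_inv := negLM_mul_negLM
  inv_val := negLM_mul_negLM

/-- Unfolding of `negUnit`. [folklore] -/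
@[simp] theorem coe_negUnit :
    ((negUnit F ι : (Module.End ℂ (piSchwartzBruhat F ι))ˣ) : Module.End ℂ (piSchwartzBruhat F ι)) =
      negLM F ι := rfl

/-- `negUnit² = 1`. [folklore] -/
theorem negUnit_mul_negUnit : negUnit F ι * negUnit F ι = 1 := Units.ext negLM_mul_negLM

/-- `Θ ∘ N = Θ` for the packaged operator `negLM`. [folklore] -/
theorem thetaDistLM_negLM (Φ : piSchwartzBruhat F ι) :
    thetaDistLM F ι (negLM F ι Φ) = thetaDistLM F ι Φ := by
  rw [thetaDistLM_apply, coe_negLM, thetaDist_comp_neg, thetaDistLM_apply]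

/-- **The reflection stabilises `Θ`.** [folklore] -/
theorem negUnit_mem_thetaStabilizer : negUnit F ι ∈ thetaStabilizer F ι := fun Φ => by
  rw [coe_negUnit]
  exact thetaDistLM_negLM Φ

end Reflection

/-! ### `𝓕 ∘ 𝓕 = N` and the Fourier transform as a unit of `End 𝒮(X_A)` -/

section Fourier

variable (F : Type) [Field F] [NumberField F] (ι : Type) [Fintype ι]
  [MeasurableSpace (AdeleRing (𝓞 F) F)] [BorelSpace (AdeleRing (𝓞 F) F)]
  (ν : Measure (ι → AdeleRing (𝓞 F) F)) [ν.IsAddHaarMeasure]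

variable {F ι ν}

/-- **Fourier inversion for the packaged operator**: `𝓕_ν(𝓕_ν Φ) = ν(D^ι)² · Φ(-·)` on `𝒮(X_A)`
(`adelicPiFourier_adelicPiFourier`). [cite: CasselsFrohlichANT1967, Ch. XV (Tate), Thm. 4.1.2] -/
theorem fourierLM_fourierLM (Φ : piSchwartzBruhat F ι) :
    fourierLM F ι ν (fourierLM F ι ν Φ) =
      (((ν (piFundamentalDomain F ι)).toReal ^ 2 : ℝ) : ℂ) • negLM F ι Φ := by
  apply Subtype.ext
  rw [coe_fourierLM, coe_fourierLM, Submodule.coe_smul, coe_negLM]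
  funext x
  rw [Pi.smul_apply, smul_eq_mul]
  exact adelicPiFourier_adelicPiFourier ν Φ.2 x

/-- **`𝓕(𝓕 Φ) = Φ(-·)` for the self-dual normalisation `ν(D^ι) = 1`.**
[cite: CasselsFrohlichANT1967, Ch. XV (Tate), Thm. 4.1.2 with Thm. 4.1.3 (2)] -/
theorem fourierLM_fourierLM_of_measure_eq_one (hν : ν (piFundamentalDomain F ι) = 1)
    (Φ : piSchwartzBruhat F ι) : fourierLM F ι ν (fourierLM F ι ν Φ) = negLM F ι Φ := by
  rw [fourierLM_fourierLM, hν, ENNReal.toReal_one, one_pow, Complex.ofReal_one, one_smul]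

/-- `𝓕 ∘ 𝓕 = N` in `End 𝒮(X_A)` (self-dual normalisation). [folklore] -/
theorem fourierLM_mul_fourierLM (hν : ν (piFundamentalDomain F ι) = 1) :
    fourierLM F ι ν * fourierLM F ι ν = negLM F ι :=
  LinearMap.ext fun Φ => fourierLM_fourierLM_of_measure_eq_one hν Φ

/-- `𝓕 ∘ (𝓕 ∘ N) = 1`: `𝓕 ∘ N` is a right inverse of `𝓕`. [folklore] -/
theorem fourierLM_mul_fourierLM_mul_negLM (hν : ν (piFundamentalDomain F ι) = 1) :
    fourierLM F ι ν * (fourierLM F ι ν * negLM F ι) = 1 := by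
  rw [← mul_assoc, fourierLM_mul_fourierLM hν, negLM_mul_negLM]

/-- `(N ∘ 𝓕) ∘ 𝓕 = 1`: `N ∘ 𝓕` is a left inverse of `𝓕`. [folklore] -/
theorem negLM_mul_fourierLM_mul_fourierLM (hν : ν (piFundamentalDomain F ι) = 1) :
    negLM F ι * fourierLM F ι ν * fourierLM F ι ν = 1 := by
  rw [mul_assoc, fourierLM_mul_fourierLM hν, negLM_mul_negLM]

/-- **`𝓕` commutes with the reflection**: `𝓕 ∘ N = N ∘ 𝓕` (a right inverse and a left inverse of the same
element of a monoid coincide; no symmetry of the Haar measure is used). [folklore] -/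
theorem fourierLM_mul_negLM_comm (hν : ν (piFundamentalDomain F ι) = 1) :
    fourierLM F ι ν * negLM F ι = negLM F ι * fourierLM F ι ν :=
  calc fourierLM F ι ν * negLM F ι
      = negLM F ι * fourierLM F ι ν * fourierLM F ι ν * (fourierLM F ι ν * negLM F ι) := by
        rw [negLM_mul_fourierLM_mul_fourierLM hν, one_mul]
    _ = negLM F ι * fourierLM F ι ν * (fourierLM F ι ν * (fourierLM F ι ν * negLM F ι)) := by
        rw [mul_assoc (negLM F ι * fourierLM F ι ν)]
    _ = negLM F ι * fourierLM F ι ν := by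
        rw [fourierLM_mul_fourierLM_mul_negLM hν, mul_one]

/-- `𝓕(Φ(-·)) = (𝓕Φ)(-·)` for `Φ ∈ 𝒮(X_A)` (self-dual normalisation), on underlying functions. [folklore] -/
theorem adelicPiFourier_comp_neg_of_measure_eq_one (hν : ν (piFundamentalDomain F ι) = 1)
    {Φ : (ι → AdeleRing (𝓞 F) F) → ℂ} (hΦ : Φ ∈ piSchwartzBruhat F ι) :
    adelicPiFourier F ι ν (fun v => Φ (-v)) = fun x => adelicPiFourier F ι ν Φ (-x) := by
  have h := congrArg (fun T : Module.End ℂ (piSchwartzBruhat F ι) =>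
    ((T ⟨Φ, hΦ⟩ : piSchwartzBruhat F ι) : (ι → AdeleRing (𝓞 F) F) → ℂ)) (fourierLM_mul_negLM_comm hν)
  simpa only [Module.End.mul_apply, coe_fourierLM, coe_negLM] using h

variable (F ι ν) in
/-- **The Fourier transform as an invertible operator of `𝒮(X_A)`** — the operator of Weil's Weyl element
`w` [Weil1964, n° 13] — for the self-dual normalisation, with inverse `𝓕 ∘ N = 𝓕³`.
[cite: Weil1964, Chap. I n° 13; CasselsFrohlichANT1967, Ch. XV Thm. 4.1.2] -/
def fourierUnit (hν : ν (piFundamentalDomain F ι) = 1) : (Module.End ℂ (piSchwartzBruhat F ι))ˣ where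
  val := fourierLM F ι ν
  inv := fourierLM F ι ν * negLM F ι
  val_inv := fourierLM_mul_fourierLM_mul_negLM hν
  inv_val := by
    rw [fourierLM_mul_negLM_comm hν]
    exact negLM_mul_fourierLM_mul_fourierLM hν

/-- Unfolding of `fourierUnit`. [folklore] -/
@[simp] theorem coe_fourierUnit (hν : ν (piFundamentalDomain F ι) = 1) :
    ((fourierUnit F ι ν hν : (Module.End ℂ (piSchwartzBruhat F ι))ˣ) :
      Module.End ℂ (piSchwartzBruhat F ι)) = fourierLM F ι ν := rfl

/-- The inverse of `fourierUnit` is `𝓕 ∘ N`. [folklore] -/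
theorem coe_fourierUnit_inv (hν : ν (piFundamentalDomain F ι) = 1) :
    (((fourierUnit F ι ν hν)⁻¹ : (Module.End ℂ (piSchwartzBruhat F ι))ˣ) :
      Module.End ℂ (piSchwartzBruhat F ι)) = fourierLM F ι ν * negLM F ι := rfl

/-- **`w² = N`**: `fourierUnit² = negUnit`. [folklore] -/
theorem fourierUnit_mul_fourierUnit (hν : ν (piFundamentalDomain F ι) = 1) :
    fourierUnit F ι ν hν * fourierUnit F ι ν hν = negUnit F ι :=
  Units.ext (fourierLM_mul_fourierLM hν)

/-- **`w⁴ = 1`** on `𝒮(X_A)`: the Fourier operator has order dividing `4`. [folklore] -/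
theorem fourierUnit_pow_four (hν : ν (piFundamentalDomain F ι) = 1) : fourierUnit F ι ν hν ^ 4 = 1 := by
  rw [show (4 : ℕ) = 2 + 2 from rfl, pow_add, pow_two, fourierUnit_mul_fourierUnit, negUnit_mul_negUnit]

variable (F ι ν) in
/-- **The Fourier transform as a linear automorphism of `𝒮(X_A)`** (self-dual normalisation). [folklore] -/
def fourierEquiv (hν : ν (piFundamentalDomain F ι) = 1) : piSchwartzBruhat F ι ≃ₗ[ℂ] piSchwartzBruhat F ι :=
  LinearMap.GeneralLinearGroup.toLinearEquiv (fourierUnit F ι ν hν)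

/-- Unfolding of `fourierEquiv`. [folklore] -/
@[simp] theorem fourierEquiv_apply (hν : ν (piFundamentalDomain F ι) = 1) (Φ : piSchwartzBruhat F ι) :
    fourierEquiv F ι ν hν Φ = fourierLM F ι ν Φ := rfl

/-- `fourierEquiv` followed by itself is the reflection. [folklore] -/
theorem fourierEquiv_fourierEquiv (hν : ν (piFundamentalDomain F ι) = 1) (Φ : piSchwartzBruhat F ι) :
    fourierEquiv F ι ν hν (fourierEquiv F ι ν hν Φ) = negLM F ι Φ := by
  rw [fourierEquiv_apply, fourierEquiv_apply, fourierLM_fourierLM_of_measure_eq_one hν]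

/-- **THE WEYL ELEMENT STABILISES `Θ`**: `fourierUnit ∈ thetaStabilizer` — `Θ(𝓕Φ) = Θ(Φ)` on `𝒮(X_A)`
(Poisson summation, `thetaDistLM_fourierLM_of_measure_eq_one`), now for an element of the GROUP
`(End 𝒮(X_A))ˣ`. This is the invariance conjunct of Weil's Théorème 6 for the generator `w ∈ Ps(X)_k` in the
concrete model. [cite: Weil1964, Chap. III n° 41, Thm 6 p. 193] -/
theorem fourierUnit_mem_thetaStabilizer (hν : ν (piFundamentalDomain F ι) = 1) :
    fourierUnit F ι ν hν ∈ thetaStabilizer F ι := fun Φ => by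
  rw [coe_fourierUnit]
  exact thetaDistLM_fourierLM_of_measure_eq_one Φ hν

/-- The inverse Weyl element stabilises `Θ` as well (a subgroup). [folklore] -/
theorem fourierUnit_inv_mem_thetaStabilizer (hν : ν (piFundamentalDomain F ι) = 1) :
    (fourierUnit F ι ν hν)⁻¹ ∈ thetaStabilizer F ι :=
  (thetaStabilizer F ι).inv_mem (fourierUnit_mem_thetaStabilizer hν)

/-- `Θ_Φ(w S) = Θ_Φ(S)` through the packaged `WeilThetaDatum` of the model. [cite: Weil1964, Chap. III n° 41,
Thm 6 p. 193] -/
theorem schwartzBruhatWeilThetaDatum_theta_fourierUnit (hν : ν (piFundamentalDomain F ι) = 1)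
    (Φ : piSchwartzBruhat F ι) (S : (Module.End ℂ (piSchwartzBruhat F ι))ˣ) :
    (schwartzBruhatWeilThetaDatum F ι).theta Φ (fourierUnit F ι ν hν * S) =
      (schwartzBruhatWeilThetaDatum F ι).theta Φ S :=
  schwartzBruhatWeilThetaDatum_theta_invariant Φ _ (fourierUnit_mem_thetaStabilizer hν) S

end Fourier

/-! ### The group generated by the rational `d(γ)`, `t(σ)` and the Weyl element -/

section Rational

variable (F : Type) [Field F] [NumberField F] {n : ℕ}
  [MeasurableSpace (AdeleRing (𝓞 F) F)] [BorelSpace (AdeleRing (𝓞 F) F)]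
  (ν : Measure (Fin n → AdeleRing (𝓞 F) F)) [ν.IsAddHaarMeasure]

variable {F ν}

/-- **The subgroup of `(End 𝒮(𝔸_Fⁿ))ˣ` generated by the rational twists `d(γ)` (`γ ∈ GL_n(F)`), the rational
second-degree characters `t(σ)` (`σ ∈ M_n(F)`) and the Weyl element `w = 𝓕` is contained in the stabiliser
of `Θ`** (`closure_ratGL_ratMatrix_le_thetaStabilizer` of `AdelicSecondDegreeCharacter` plus
`fourierUnit_mem_thetaStabilizer`). [cite: Weil1964, Chap. III n° 41, Thm 6 p. 193] -/
theorem closure_ratGL_ratMatrix_fourierUnit_le_thetaStabilizer (hν : ν (piFundamentalDomain F (Fin n)) = 1) :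
    Subgroup.closure
        (((Set.range fun γ : GL (Fin n) F => twistUnit F n (ratGL F γ)) ∪
            Set.range fun σ : Matrix (Fin n) (Fin n) F =>
              chirpUnit F n (Multiplicative.ofAdd (ratMatrix F σ))) ∪
          {fourierUnit F (Fin n) ν hν}) ≤
      thetaStabilizer F (Fin n) := by
  rw [Subgroup.closure_le]
  rintro S ((⟨γ, rfl⟩ | ⟨σ, rfl⟩) | hS)
  · exact twistUnit_ratGL_mem_thetaStabilizer γ
  · exact chirpUnit_ratMatrix_mem_thetaStabilizer σ
  · rw [Set.mem_singleton_iff] at hS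
    subst hS
    exact fourierUnit_mem_thetaStabilizer hν

/-- Every element of that subgroup fixes `Θ`: `Θ(SΦ) = Θ(Φ)`. [cite: Weil1964, Chap. III n° 41, Thm 6 p. 193] -/
theorem thetaDistLM_eq_of_mem_closure (hν : ν (piFundamentalDomain F (Fin n)) = 1)
    {S : (Module.End ℂ (piSchwartzBruhat F (Fin n)))ˣ}
    (hS : S ∈ Subgroup.closure
        (((Set.range fun γ : GL (Fin n) F => twistUnit F n (ratGL F γ)) ∪
            Set.range fun σ : Matrix (Fin n) (Fin n) F =>
              chirpUnit F n (Multiplicative.ofAdd (ratMatrix F σ))) ∪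
          {fourierUnit F (Fin n) ν hν}))
    (Φ : piSchwartzBruhat F (Fin n)) :
    thetaDistLM F (Fin n) ((S : Module.End ℂ (piSchwartzBruhat F (Fin n))) Φ) = thetaDistLM F (Fin n) Φ :=
  (closure_ratGL_ratMatrix_fourierUnit_le_thetaStabilizer hν hS) Φ

end Rational

end Literature.NumberTheory.Weil1964

end
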